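import Literature.Probability.RandomPlanarGeometry.HexSAWPolygonStepTwoTwoCorner
import HarnessLib

/-!
# The step `2` for honeycomb polygon numbers, THIRD SLOT (I): the LEAF SLIDE at a top-right leaf with a long support
# `#{X ∪ Y⋆ ∪ (leaf ∩ bottom-served) ∪ leaf-slide} ≤ q_{N+2}(ℍ)`

Topic `Literature/Probability/RandomPlanarGeometry` (lane «pcv-sawmu», a-p4 g20; sequel of `HexSAWPolygonStepTwoTwoCorner.lean` — the
two-corner injection `card_filter_isStepTwoTwoCorner_le`, `IsStepTwoTwoCorner`, `IsStepTwoBottom`, `BottomDatum`,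
`exists_stepTwoBottom_image`, `eq_of_stepTwoBottom_image_eq`, `isTopLeaf_of_bottomDatum`, `topSix_of_isTopLeaf` —, of
`HexSAWPolygonStepTwoYStar.lean` — `IsTopLeaf`, `IsStepTwoRoof`, `RoofDatum`, `exists_stepTwoRoof_image`, `eq_of_stepTwoRoof_image_eq`,
`not_isTopLeaf_of_roofDatum`, `spliceYs_sites_fwd/bwd`, `topAt_spliceYs`, `notX_pred_fwd`, `notX_succ_bwd`, `corner_pred_of_succ_down`,
`corner_succ_of_pred_down` — and of `HexSAWPolygonStepTwoMain.lean` / `HexSAWPolygonStepSix.lean` — `spliceAdd`, `SpliceAddOK`,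
`spliceAddOK_of_tables`, `eq_of_spliceAdd_eq`, `topAt_spliceAdd`, `spliceAdd_site_cases`, `tpath`, `rd`, `TopSix`, `topAt_unique`,
`top_corner_pred`, `top_corner_succ`).

The two-corner injection leaves the residue «top-right hexagon an up-right LEAF and not served at the bottom corner» (numerically: top-right
leaf ∧ bottom-right leaf; `1, 0, 3, 2, 14, 22, 89, 192, 663` of `12, …, 25 999` for `N = 14, …, 30`).  Write the top corner as
`(xm, H) = ω i₀`; the top-right hexagon is `c = [xm−2,xm]×[H−1,H]` and hangs on `d = [xm−3,xm−1]×[H−2,H−1]` only.  When the run of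
hexagons of the row below ending at `d` has length `≥ 2` (i.e. `[xm−5,xm−3]×[H−2,H−1]` is a hexagon of the polygon: in walk terms the
site five steps before/after the corner is `(xm−4, H−1)`) and the hexagon `[xm−6,xm−4]×[H−1,H]` two places left of `c` is NOT in the
polygon (the site `(xm−4, H)` is off `ω`), the **leaf slide** removes `c`, re-attaches it one place to the left (where it hangs on TWO
hexagons, `d` and its left neighbour: `−4 + 2`) and crowns it with the hexagon `[xm−5,xm−3]×[H,H+1]` (`+4`): net `+2`.  As a surgery on
the boundary walk this is ONE fixed window of `8` bonds, `(xm−4,H−1)(xm−3,H−1)(xm−2,H−1)(xm−2,H)(xm−1,H)(xm,H)(xm,H−1)(xm−1,H−1)(xm−1,H−2)`,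
replaced by the `10`-bond path `(xm−4,H−1)(xm−4,H)(xm−5,H)(xm−5,H+1)(xm−4,H+1)(xm−3,H+1)(xm−3,H)(xm−2,H)(xm−2,H−1)(xm−1,H−1)(xm−1,H−2)`
(tables `wU`, `offU`; `spliceAdd 2 8`).  It is admissible with NO further side condition and never undercuts the root (`xm ≥ 5` is
forced).  The image's top corner is `(xm−3, H+1)`; its top-right hexagon is an up-LEFT leaf: below the corner the walk turns RIGHT and the
site `(xm−4, H)` one step down-left of the corner is ON the image — which separates the slide images from the case-X images (that site is
the interior vertex under their top hexagon), from the roof images (they carry `(x−3, H')` on the top row; a slide image does not) and from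
every top-leaf walk (leaves turn LEFT below the corner), in particular from the bottom images of the two-corner map.

PART I: tables, admissibility `spliceOK_U`, the forced window `stepTwo_data_U_fwd/bwd`, the image corner `topAt_spliceU`, image sites,
decoding `spliceU_decode`, the cross lemmas `not_isTopLeaf_of_slideDatum`, `not_roof_of_slideDatum`.
PART II: the class `IsLeafSlide`, `SlideDatum`, `exists_leafSlide_image`, `eq_of_leafSlide_image_eq`, and the THREE-SLOT injection
★ **`card_filter_isStepTwoThreeSlot_le : 5 ≤ n → #{ω ∈ canonEnd n | IsStepTwoThreeSlot n ω} ≤ #canonEnd (n+2)`** with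
`IsStepTwoThreeSlot n ω := IsStepTwoTwoCorner n ω ∨ IsLeafSlide n ω`, the complement form and the printed normalisation
`q_{n+1}(ℍ) − #{leaf ∧ ¬bottom-served ∧ ¬slide} ≤ q_{n+3}(ℍ)`.

NOT claimed: `q_N(ℍ) ≤ q_{N+2}(ℍ)`.  Numerically (lane scripts `HOME/pub-sawmu-a-p4/g20/three/py/slideUV.py`, door note
`DOOR-STEP-TWO-THIRD-SLOT-g20.md` §1) the slide serves `0, 0, 1, 1, 6, 9, 37, 78, 270` of the two-corner residue for `N = 14, …, 30` and the
new residue is `1, 0, 2, 1, 8, 13, 52, 114, 393` (top leaf whose support run has length `1`, or with the hexagon two places left present —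
the latter, `0,0,0,0,1,2,11,21,87`, is served by the companion fixed-window move «fill the gap and crown `c`», left to the sequel).
Label (lane): LANE LEMMA / infrastructure for an open combinatorial item; no literature claim beyond the transplanted `ℤ^d` method.
-/

noncomputable section

open Finset Function Literature.Probability.LatticeModels Literature.Probability.Percolation SimpleGraph

namespace Literature.Probability.RandomPlanarGeometry.SAW

namespace HexBW

namespace PolygonConcat

variable {n : ℕ} {ω : ℕ → Site 2}

/-- Two sites of `ℤ²` are equal iff both coordinates agree. [folklore; lane plumbing] [cite: MadrasSlade1993, §1.1] -/
private theorem ls_site_eq_iff {x y : Site 2} : x = y ↔ x 0 = y 0 ∧ x 1 = y 1 := by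
  constructor
  · rintro rfl; exact ⟨rfl, rfl⟩
  · rintro ⟨h0, h1⟩; funext i; fin_cases i <;> assumption

/-- `pt a b` is lexicographically `≥ 0` when `a > 0`, or `a = 0 ≤ b`. [cite: MadrasSlade1993, §3.2 (proof of Theorem 3.2.3: `Q[N]`)] -/
private theorem ls_lexNonneg_pt {a b : ℤ} (h : 0 < a ∨ (a = 0 ∧ 0 ≤ b)) : LexNonneg (pt a b) := by
  unfold LexNonneg; simpa using h

/-! ### PART I — the leaf slide as a fixed-window surgery -/

section SlideTables

variable {xm H : ℤ} {fwd : Bool} {j : ℕ}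

/-- Window table of the leaf slide (offsets from the top corner `(xm,H)`): `(xm−4,H−1)(xm−3,H−1)(xm−2,H−1)(xm−2,H)(xm−1,H)(xm,H)
(xm,H−1)(xm−1,H−1)(xm−1,H−2)` — the boundary walk around the top-right leaf hexagon and the top of its support run.
[cite: MadrasSlade1993, §3.2 (proof of Theorem 3.2.3: local surgery at the lexicographically largest point)] -/
def wU : ℕ → ℤ × ℤ
  | 0 => (-4, -1) | 1 => (-3, -1) | 2 => (-2, -1) | 3 => (-2, 0) | 4 => (-1, 0) | 5 => (0, 0) | 6 => (0, -1) | 7 => (-1, -1)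
  | _ => (-1, -2)

/-- New-path table of the leaf slide: `(xm−4,H−1)(xm−4,H)(xm−5,H)(xm−5,H+1)(xm−4,H+1)(xm−3,H+1)(xm−3,H)(xm−2,H)(xm−2,H−1)(xm−1,H−1)
(xm−1,H−2)` — around the slid hexagon `[xm−4,xm−2]×[H−1,H]` and its crown `[xm−5,xm−3]×[H,H+1]`.
[cite: MadrasSlade1993, §3.2 (proof of Theorem 3.2.3: local surgery)] -/
def offU : ℕ → ℤ × ℤ
  | 0 => (-4, -1) | 1 => (-4, 0) | 2 => (-5, 0) | 3 => (-5, 1) | 4 => (-4, 1) | 5 => (-3, 1) | 6 => (-3, 0) | 7 => (-2, 0)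
  | 8 => (-2, -1) | 9 => (-1, -1) | _ => (-1, -2)

/-- Table U is a brick-wall path (given the top-corner parity `xm + H` odd). [cite: EntingJensen2009, §7.4.2, Fig. 7.10] -/
theorem offU_adj (hpar : (xm + H) % 2 = 1) {s : ℕ} (hs : s < 10) :
    brickWallGraph.Adj (pt (xm + (offU s).1) (H + (offU s).2)) (pt (xm + (offU (s + 1)).1) (H + (offU (s + 1)).2)) := by
  interval_cases s <;> simp only [offU] <;> exact adj_pt_iff.2 (by omega)

/-- Table U is injective on `[0,10]`. [cite: MadrasSlade1993, §3.2] -/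
theorem offU_inj {s s' : ℕ} (hs : s ≤ 10) (hs' : s' ≤ 10)
    (h : pt (xm + (offU s).1) (H + (offU s).2) = pt (xm + (offU s').1) (H + (offU s').2)) : s = s' := by
  interval_cases s <;> interval_cases s' <;> simp only [offU] at h <;>
    first | rfl | (obtain ⟨h1, h2⟩ := pt_inj.1 h; omega)

/-- **The leaf slide is admissible**: for `xm ≥ 5`, `H ≥ 1`, the sites `(xm−3,H)`, `(xm−4,H)`, `(xm−5,H)` off `ω`, and the window `wU`
read on `ω` from time `j` (in direction `fwd`), the new path satisfies `SpliceAddOK n 2 8`.  Freshness: the three crown sites have height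
`H+1`; `(xm−3,H)`, `(xm−4,H)`, `(xm−5,H)` are off `ω` by hypothesis; `(xm−2,H)`, `(xm−2,H−1)`, `(xm−1,H−1)` are window sites of `ω`, met
by no time outside the window (injectivity). [cite: MadrasSlade1993, §3.2 (proof of Theorem 3.2.3: local surgery)] -/
theorem spliceOK_U (hω : ω ∈ endAt n (Pi.single 0 1 : Site 2)) (hpar : (xm + H) % 2 = 1) (hx : 5 ≤ xm) (hH : 1 ≤ H)
    (hmaxH : ∀ i, i ≤ n → ω i 1 ≤ H) (hmaxX : ∀ i, i ≤ n → ω i 1 = H → ω i 0 ≤ xm)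
    (hX3 : ∀ t, t ≤ n → ω t ≠ pt (xm - 3) H) (hX4 : ∀ t, t ≤ n → ω t ≠ pt (xm - 4) H) (hX5 : ∀ t, t ≤ n → ω t ≠ pt (xm - 5) H)
    (hw : ∀ s, s ≤ 8 → ω (j + s) = tpath wU 8 xm H fwd s) (hwnd : j + 8 ≤ n) :
    SpliceAddOK n 2 8 ω j (tpath offU 10 xm H fwd) := by
  have hinj := (mem_endAt_iff.1 hω).1.2.2.2
  -- a window site is met by no time outside the window
  have hwin : ∀ u, u ≤ 8 → ∀ i, i ≤ n → (i < j ∨ j + 8 < i) → pt (xm + (wU u).1) (H + (wU u).2) ≠ ω i := by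
    intro u hu i hi hio he
    -- the window index reading `u`
    have hs : ∃ s, s ≤ 8 ∧ rd fwd 8 s = u := by
      cases fwd
      · exact ⟨8 - u, by omega, by unfold rd; simp; omega⟩
      · exact ⟨u, hu, by unfold rd; simp⟩
    obtain ⟨s, hs8, hsu⟩ := hs
    have e : ω (j + s) = pt (xm + (wU u).1) (H + (wU u).2) := by rw [hw s hs8, tpath, hsu]
    have := hinj (show j + s ∈ {i | i ≤ n} by simp; omega) (show i ∈ {i | i ≤ n} by simpa using hi) (by rw [e, he])
    omega
  refine spliceAddOK_of_tables (L := 8) (K := 2) (w := wU) (by norm_num) (by rfl) (by rfl) (fun s hs => offU_adj hpar hs)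
    (fun s s' hs hs' h => offU_inj hs hs' h) (fun u hu0 hu1 i hi hio => ?_) (fun u hu => ?_) hw hwnd
  · interval_cases u <;> simp only [offU]
    · exact fun h => hX4 i hi (h.symm.trans (pt_inj.2 ⟨by ring, by ring⟩))
    · exact fun h => hX5 i hi (h.symm.trans (pt_inj.2 ⟨by ring, by ring⟩))
    · exact ne_of_high hmaxH hmaxX (by omega) hi
    · exact ne_of_high hmaxH hmaxX (by omega) hi
    · exact ne_of_high hmaxH hmaxX (by omega) hi
    · exact fun h => hX3 i hi (h.symm.trans (pt_inj.2 ⟨by ring, by ring⟩))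
    · exact hwin 3 (by norm_num) i hi hio
    · exact hwin 2 (by norm_num) i hi hio
    · exact hwin 7 (by norm_num) i hi hio
  · interval_cases u <;> simp only [offU] <;> exact ls_lexNonneg_pt (by omega)

/-- **The slide image is a canonical `(n+3)`-gon.** [cite: MadrasSlade1993, §3.2 (proof of Theorem 3.2.3)] -/
theorem spliceU_mem_canonEnd (hω : ω ∈ canonEnd n) (hpar : (xm + H) % 2 = 1) (hx : 5 ≤ xm) (hH : 1 ≤ H)
    (hmaxH : ∀ i, i ≤ n → ω i 1 ≤ H) (hmaxX : ∀ i, i ≤ n → ω i 1 = H → ω i 0 ≤ xm)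
    (hX3 : ∀ t, t ≤ n → ω t ≠ pt (xm - 3) H) (hX4 : ∀ t, t ≤ n → ω t ≠ pt (xm - 4) H) (hX5 : ∀ t, t ≤ n → ω t ≠ pt (xm - 5) H)
    (hw : ∀ s, s ≤ 8 → ω (j + s) = tpath wU 8 xm H fwd s) (hwnd : j + 8 ≤ n) :
    spliceAdd 2 8 ω (tpath offU 10 xm H fwd) j ∈ canonEnd (n + 2) :=
  spliceAdd_mem_canonEnd hω (spliceOK_U (mem_canonEnd.1 hω).1 hpar hx hH hmaxH hmaxX hX3 hX4 hX5 hw hwnd)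

end SlideTables


/-! ### The forced window around a top-right leaf with a long support -/

section SlideData

variable {xm H : ℤ}

/-- **A top-row site has both horizontal walk-neighbours**: if `(xm−4, H)` is off `ω` then so is `(xm−5, H)` (its vertical bond points
up, above the top row; its right neighbour is `(xm−4,H)`). [cite: EntingJensen2009, §7.4.2, Fig. 7.10 (brickwork form of the honeycomb lattice)] -/
theorem free5_of_free4 (hω : ω ∈ endAt n (Pi.single 0 1 : Site 2)) (hpar : (xm + H) % 2 = 1) (hH : 1 ≤ H)
    (hmaxH : ∀ i, i ≤ n → ω i 1 ≤ H) (hX4 : ∀ t, t ≤ n → ω t ≠ pt (xm - 4) H) :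
    ∀ t, t ≤ n → ω t ≠ pt (xm - 5) H := by
  obtain ⟨⟨h0, -, hbw, hinj⟩, hn'⟩ := mem_endAt_iff.1 hω
  intro t ht he
  have ht0 : t ≠ 0 := by intro h; rw [h, h0] at he; have := congrFun he 1; simp at this; omega
  have htn : t ≠ n := by intro h; rw [h, hn'] at he; have := congrFun he 1; simp at this; omega
  -- both walk-neighbours of `(xm−5, H)` are its LEFT neighbour
  have key : ∀ i, i ≤ n → brickWallGraph.Adj (ω t) (ω i) → ω i = pt (xm - 6) H := by
    intro i hi hadj
    rw [he] at hadj
    rcases adj_cases hadj with ⟨hz0, hz1⟩ | ⟨hz0, hz1⟩ | hz0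
    · exfalso; apply hX4 i hi; rw [ls_site_eq_iff]; simp only [pt_apply_zero, pt_apply_one] at hz0 hz1 ⊢; omega
    · rw [ls_site_eq_iff]; simp only [pt_apply_zero, pt_apply_one] at hz0 hz1 ⊢; omega
    · rcases vertical_cases hadj hz0 with ⟨hy, hp⟩ | ⟨hy, hp⟩
      · exfalso; have := hmaxH i hi; simp only [pt_apply_one] at hy; omega
      · exfalso; simp only [pt_apply_zero, pt_apply_one] at hz0 hy hp; omega
  have h1 := key (t + 1) (by omega) (hbw t (by omega))
  have h2 := key (t - 1) (by omega)
    (by have := hbw (t - 1) (by omega); rw [show t - 1 + 1 = t by omega] at this; exact this.symm)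
  have := hinj (show t + 1 ∈ {i | i ≤ n} by simp; omega) (show t - 1 ∈ {i | i ≤ n} by simp; omega) (by rw [h1, h2])
  omega

/-- **Leaf-slide datum, forward.**  At a top corner `ω i₀ = (xm,H)` of the LEAF class (`(xm−3,H)` off `ω`, `ω (i₀+1) = (xm,H−1)`,
`ω (i₀+2) = (xm−1,H−1)`) whose support run is long (`ω (i₀−5) = (xm−4,H−1)`) and with `(xm−4,H)` off `ω`, the whole `8`-window from time
`i₀ − 5` is forced — `(xm−4,H−1)(xm−3,H−1)(xm−2,H−1)(xm−2,H)(xm−1,H)(xm,H)(xm,H−1)(xm−1,H−1)(xm−1,H−2)` —, `xm ≥ 5`, and the leaf slide is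
admissible there. [cite: MadrasSlade1993, §3.2 (proof of Theorem 3.2.3: the local structure at the lexicographically largest point)] -/
theorem stepTwo_data_U_fwd (hω : ω ∈ canonEnd n) {i₀ : ℕ} (hi₀n : i₀ + 2 ≤ n) (hv : ω i₀ = pt xm H) (hx2 : 2 ≤ xm)
    (hmaxH : ∀ i, i ≤ n → ω i 1 ≤ H) (hmaxX : ∀ i, i ≤ n → ω i 1 = H → ω i 0 ≤ xm)
    (hX3 : ∀ t, t ≤ n → ω t ≠ pt (xm - 3) H) (hX4 : ∀ t, t ≤ n → ω t ≠ pt (xm - 4) H)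
    (hs1 : ω (i₀ + 1) = pt xm (H - 1)) (hs2 : ω (i₀ + 2) = pt (xm - 1) (H - 1))
    (hi₀5 : 5 ≤ i₀) (hp5 : ω (i₀ - 5) = pt (xm - 4) (H - 1)) :
    5 ≤ xm ∧ i₀ + 3 ≤ n ∧ SpliceAddOK n 2 8 ω (i₀ - 5) (tpath offU 10 xm H true) ∧
      (∀ s, s ≤ 8 → ω (i₀ - 5 + s) = tpath wU 8 xm H true s) := by
  obtain ⟨hE, hlex⟩ := mem_canonEnd.1 hω
  obtain ⟨⟨h0, -, hbw, hinj⟩, hn'⟩ := mem_endAt_iff.1 hE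
  have hH1 : 1 ≤ H := by
    have h1 := apply_one_of_mem_canonEnd hω (by omega); have := hmaxH 1 (by omega); rw [h1.2] at this; exact this
  have hpar : (xm + H) % 2 = 1 := by
    have hvc := vertical_cases (hbw i₀ (by omega)) (by rw [hv, hs1]; simp)
    rw [hv, hs1] at hvc; simp only [pt_apply_zero, pt_apply_one] at hvc; omega
  obtain ⟨hi₀1, p1⟩ := corner_pred_of_succ_down hE hx2 hmaxH hmaxX (by omega) hv hs1
  obtain ⟨hi₀2, p2⟩ := top_corner_pred hω hi₀1 (by omega) hv hmaxH p1 hs1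
  obtain ⟨hi₀3, p3⟩ := notX_pred_fwd hE hpar hH1 hmaxH hi₀2 (by omega) p2 p1 hX3
  -- `ω (i₀−4) = (xm−3, H−1)`: from `(xm−2,H−1)` the vertical bond goes up to `ω (i₀−2)`, the right neighbour is `ω (i₀+2)`
  have p4 : ω (i₀ - 4) = pt (xm - 3) (H - 1) := by
    have hadj : brickWallGraph.Adj (ω (i₀ - 3)) (ω (i₀ - 4)) := by
      have := hbw (i₀ - 4) (by omega); rw [show i₀ - 4 + 1 = i₀ - 3 by omega] at this; exact this.symm
    rw [p3] at hadj
    have hne2 : ω (i₀ - 4) ≠ ω (i₀ + 2) := fun h => by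
      have := hinj (show i₀ - 4 ∈ {i | i ≤ n} by simp; omega) (show i₀ + 2 ∈ {i | i ≤ n} by simp; omega) h; omega
    have hne3 : ω (i₀ - 4) ≠ ω (i₀ - 2) := fun h => by
      have := hinj (show i₀ - 4 ∈ {i | i ≤ n} by simp; omega) (show i₀ - 2 ∈ {i | i ≤ n} by simp; omega) h; omega
    rcases adj_cases hadj with ⟨hz0, hz1⟩ | ⟨hz0, hz1⟩ | hz0
    · exfalso; apply hne2; rw [hs2, ls_site_eq_iff]; simp only [pt_apply_zero, pt_apply_one] at hz0 hz1 ⊢; omega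
    · rw [ls_site_eq_iff]; simp only [pt_apply_zero, pt_apply_one] at hz0 hz1 ⊢; omega
    · rcases vertical_cases hadj hz0 with ⟨hy, hp⟩ | ⟨hy, hp⟩
      · exfalso; apply hne3; rw [p2, ls_site_eq_iff]; simp only [pt_apply_zero, pt_apply_one] at hz0 hy ⊢; omega
      · exfalso; simp only [pt_apply_zero, pt_apply_one] at hz0 hy hp; omega
  -- `i₀ ≥ 6`: otherwise `ω (i₀−5)` is the root `(0,0)`, so `H = 1`, `xm = 4`, and `ω 1 = (0,1) = (xm−4,H)` is on `ω`
  have hi₀6 : 6 ≤ i₀ := by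
    by_contra hlt
    have h5 : i₀ - 5 = 0 := by omega
    rw [h5, h0] at hp5
    have e0 := congrFun hp5 0; have e1 := congrFun hp5 1; simp at e0 e1
    have h1 := apply_one_of_mem_canonEnd hω (by omega)
    apply hX4 1 (by omega); rw [ls_site_eq_iff]; simp only [pt_apply_zero, pt_apply_one]; omega
  -- `ω (i₀−6) = (xm−5, H−1)`: from `(xm−4,H−1)` the vertical bond goes up to `(xm−4,H)` (off `ω`), the right neighbour is `ω (i₀−4)`
  have p6 : ω (i₀ - 6) = pt (xm - 5) (H - 1) := by
    have hadj : brickWallGraph.Adj (ω (i₀ - 5)) (ω (i₀ - 6)) := by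
      have := hbw (i₀ - 6) (by omega); rw [show i₀ - 6 + 1 = i₀ - 5 by omega] at this; exact this.symm
    rw [hp5] at hadj
    have hne : ω (i₀ - 6) ≠ ω (i₀ - 4) := fun h => by
      have := hinj (show i₀ - 6 ∈ {i | i ≤ n} by simp; omega) (show i₀ - 4 ∈ {i | i ≤ n} by simp; omega) h; omega
    rcases adj_cases hadj with ⟨hz0, hz1⟩ | ⟨hz0, hz1⟩ | hz0
    · exfalso; apply hne; rw [p4, ls_site_eq_iff]; simp only [pt_apply_zero, pt_apply_one] at hz0 hz1 ⊢; omega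
    · rw [ls_site_eq_iff]; simp only [pt_apply_zero, pt_apply_one] at hz0 hz1 ⊢; omega
    · rcases vertical_cases hadj hz0 with ⟨hy, hp⟩ | ⟨hy, hp⟩
      · exfalso; apply hX4 (i₀ - 6) (by omega); rw [ls_site_eq_iff]; simp only [pt_apply_zero, pt_apply_one] at hz0 hy ⊢; omega
      · exfalso; simp only [pt_apply_zero, pt_apply_one] at hz0 hy hp; omega
  have hx5 : 5 ≤ xm := by
    have := hlex (i₀ - 6) (by omega); rw [p6] at this; unfold LexNonneg at this
    simp only [pt_apply_zero, pt_apply_one] at this; omega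
  -- `i₀ + 3 ≤ n`: otherwise `ω (i₀+2)` is the end `e₀ = (1,0)`, so `xm = 2`
  have hi₀3n : i₀ + 3 ≤ n := by
    by_contra hlt
    have h2 : i₀ + 2 = n := by omega
    rw [h2, hn'] at hs2
    have e0 := congrFun hs2 0; simp at e0; omega
  -- `ω (i₀+3) = (xm−1, H−2)`: from `(xm−1,H−1)` the vertical bond goes down; left is `ω (i₀−3)`, right is `ω (i₀+1)`
  have s3 : ω (i₀ + 3) = pt (xm - 1) (H - 2) := by
    have hadj : brickWallGraph.Adj (ω (i₀ + 2)) (ω (i₀ + 3)) := hbw (i₀ + 2) (by omega)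
    rw [hs2] at hadj
    have hne1 : ω (i₀ + 3) ≠ ω (i₀ + 1) := fun h => by
      have := hinj (show i₀ + 3 ∈ {i | i ≤ n} by simp; omega) (show i₀ + 1 ∈ {i | i ≤ n} by simp; omega) h; omega
    have hne3 : ω (i₀ + 3) ≠ ω (i₀ - 3) := fun h => by
      have := hinj (show i₀ + 3 ∈ {i | i ≤ n} by simp; omega) (show i₀ - 3 ∈ {i | i ≤ n} by simp; omega) h; omega
    rcases adj_cases hadj with ⟨hz0, hz1⟩ | ⟨hz0, hz1⟩ | hz0
    · exfalso; apply hne1; rw [hs1, ls_site_eq_iff]; simp only [pt_apply_zero, pt_apply_one] at hz0 hz1 ⊢; omega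
    · exfalso; apply hne3; rw [p3, ls_site_eq_iff]; simp only [pt_apply_zero, pt_apply_one] at hz0 hz1 ⊢; omega
    · rcases vertical_cases hadj hz0 with ⟨hy, hp⟩ | ⟨hy, hp⟩
      · exfalso; simp only [pt_apply_zero, pt_apply_one] at hz0 hy hp; omega
      · rw [ls_site_eq_iff]; simp only [pt_apply_zero, pt_apply_one] at hz0 hy ⊢; omega
  have hX5 := free5_of_free4 hE hpar hH1 hmaxH hX4
  have hw : ∀ s, s ≤ 8 → ω (i₀ - 5 + s) = tpath wU 8 xm H true s := by
    intro s hs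
    interval_cases s
    · exact tpath_eq (by rw [show i₀ - 5 + 0 = i₀ - 5 by omega, hp5]) (by simp [rd, wU])
    · exact tpath_eq (by rw [show i₀ - 5 + 1 = i₀ - 4 by omega, p4]) (by simp [rd, wU])
    · exact tpath_eq (by rw [show i₀ - 5 + 2 = i₀ - 3 by omega, p3]) (by simp [rd, wU])
    · exact tpath_eq (by rw [show i₀ - 5 + 3 = i₀ - 2 by omega, p2]) (by simp [rd, wU])
    · exact tpath_eq (by rw [show i₀ - 5 + 4 = i₀ - 1 by omega, p1]) (by simp [rd, wU])
    · exact tpath_eq (by rw [show i₀ - 5 + 5 = i₀ by omega, hv]) (by simp [rd, wU])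
    · exact tpath_eq (by rw [show i₀ - 5 + 6 = i₀ + 1 by omega, hs1]) (by simp [rd, wU])
    · exact tpath_eq (by rw [show i₀ - 5 + 7 = i₀ + 2 by omega, hs2]) (by simp [rd, wU])
    · exact tpath_eq (by rw [show i₀ - 5 + 8 = i₀ + 3 by omega, s3]) (by simp [rd, wU])
  exact ⟨hx5, hi₀3n, spliceOK_U hE hpar hx5 hH1 hmaxH hmaxX hX3 hX4 hX5 hw (by omega), hw⟩

/-- **Leaf-slide datum, backward** (the mirror image in time: `ω (i₀−1) = (xm,H−1)`, `ω (i₀−2) = (xm−1,H−1)`, `ω (i₀+5) = (xm−4,H−1)`):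
the `8`-window sits at `i₀ − 3` and is read backwards. [cite: MadrasSlade1993, §3.2 (proof of Theorem 3.2.3)] -/
theorem stepTwo_data_U_bwd (hω : ω ∈ canonEnd n) {i₀ : ℕ} (hi₀2 : 2 ≤ i₀) (hi₀5n : i₀ + 5 ≤ n) (hv : ω i₀ = pt xm H) (hx2 : 2 ≤ xm)
    (hmaxH : ∀ i, i ≤ n → ω i 1 ≤ H) (hmaxX : ∀ i, i ≤ n → ω i 1 = H → ω i 0 ≤ xm)
    (hX3 : ∀ t, t ≤ n → ω t ≠ pt (xm - 3) H) (hX4 : ∀ t, t ≤ n → ω t ≠ pt (xm - 4) H)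
    (hp1 : ω (i₀ - 1) = pt xm (H - 1)) (hp2 : ω (i₀ - 2) = pt (xm - 1) (H - 1))
    (hs5 : ω (i₀ + 5) = pt (xm - 4) (H - 1)) :
    5 ≤ xm ∧ 3 ≤ i₀ ∧ SpliceAddOK n 2 8 ω (i₀ - 3) (tpath offU 10 xm H false) ∧
      (∀ s, s ≤ 8 → ω (i₀ - 3 + s) = tpath wU 8 xm H false s) := by
  obtain ⟨hE, hlex⟩ := mem_canonEnd.1 hω
  obtain ⟨⟨h0, -, hbw, hinj⟩, hn'⟩ := mem_endAt_iff.1 hE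
  have hH1 : 1 ≤ H := by
    have h1 := apply_one_of_mem_canonEnd hω (by omega); have := hmaxH 1 (by omega); rw [h1.2] at this; exact this
  have hpar : (xm + H) % 2 = 1 := by
    have hvc := vertical_cases (hbw (i₀ - 1) (by omega)) (by rw [show i₀ - 1 + 1 = i₀ by omega, hv, hp1]; simp)
    rw [show i₀ - 1 + 1 = i₀ by omega, hv, hp1] at hvc; simp only [pt_apply_zero, pt_apply_one] at hvc; omega
  obtain ⟨hi₀1n, s1⟩ := corner_succ_of_pred_down hE hx2 hmaxH hmaxX (by omega) (by omega) hv hp1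
  obtain ⟨hi₀2n, s2⟩ := top_corner_succ hω (by omega) hi₀1n hv hmaxH s1 hp1
  obtain ⟨hi₀3n, s3⟩ := notX_succ_bwd hE hpar hH1 hmaxH hi₀2n s2 s1 hX3
  -- `ω (i₀+4) = (xm−3, H−1)`
  have s4 : ω (i₀ + 4) = pt (xm - 3) (H - 1) := by
    have hadj : brickWallGraph.Adj (ω (i₀ + 3)) (ω (i₀ + 4)) := hbw (i₀ + 3) (by omega)
    rw [s3] at hadj
    have hne2 : ω (i₀ + 4) ≠ ω (i₀ - 2) := fun h => by
      have := hinj (show i₀ + 4 ∈ {i | i ≤ n} by simp; omega) (show i₀ - 2 ∈ {i | i ≤ n} by simp; omega) h; omega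
    have hne3 : ω (i₀ + 4) ≠ ω (i₀ + 2) := fun h => by
      have := hinj (show i₀ + 4 ∈ {i | i ≤ n} by simp; omega) (show i₀ + 2 ∈ {i | i ≤ n} by simp; omega) h; omega
    rcases adj_cases hadj with ⟨hz0, hz1⟩ | ⟨hz0, hz1⟩ | hz0
    · exfalso; apply hne2; rw [hp2, ls_site_eq_iff]; simp only [pt_apply_zero, pt_apply_one] at hz0 hz1 ⊢; omega
    · rw [ls_site_eq_iff]; simp only [pt_apply_zero, pt_apply_one] at hz0 hz1 ⊢; omega
    · rcases vertical_cases hadj hz0 with ⟨hy, hp⟩ | ⟨hy, hp⟩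
      · exfalso; apply hne3; rw [s2, ls_site_eq_iff]; simp only [pt_apply_zero, pt_apply_one] at hz0 hy ⊢; omega
      · exfalso; simp only [pt_apply_zero, pt_apply_one] at hz0 hy hp; omega
  -- `xm ≥ 5`: if `i₀ + 5 = n` then `ω n = e₀ = (1,0) = (xm−4, H−1)`; otherwise `ω (i₀+6) = (xm−5, H−1)` is lexicographically `≥ 0`
  have hx5 : 5 ≤ xm := by
    rcases eq_or_lt_of_le hi₀5n with h5 | h5
    · rw [h5, hn'] at hs5; have e0 := congrFun hs5 0; simp at e0; omega
    · have s6 : ω (i₀ + 6) = pt (xm - 5) (H - 1) := by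
        have hadj : brickWallGraph.Adj (ω (i₀ + 5)) (ω (i₀ + 6)) := hbw (i₀ + 5) (by omega)
        rw [hs5] at hadj
        have hne : ω (i₀ + 6) ≠ ω (i₀ + 4) := fun h => by
          have := hinj (show i₀ + 6 ∈ {i | i ≤ n} by simp; omega) (show i₀ + 4 ∈ {i | i ≤ n} by simp; omega) h; omega
        rcases adj_cases hadj with ⟨hz0, hz1⟩ | ⟨hz0, hz1⟩ | hz0
        · exfalso; apply hne; rw [s4, ls_site_eq_iff]; simp only [pt_apply_zero, pt_apply_one] at hz0 hz1 ⊢; omega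
        · rw [ls_site_eq_iff]; simp only [pt_apply_zero, pt_apply_one] at hz0 hz1 ⊢; omega
        · rcases vertical_cases hadj hz0 with ⟨hy, hp⟩ | ⟨hy, hp⟩
          · exfalso; apply hX4 (i₀ + 6) (by omega); rw [ls_site_eq_iff]
            simp only [pt_apply_zero, pt_apply_one] at hz0 hy ⊢; omega
          · exfalso; simp only [pt_apply_zero, pt_apply_one] at hz0 hy hp; omega
      have := hlex (i₀ + 6) (by omega); rw [s6] at this; unfold LexNonneg at this
      simp only [pt_apply_zero, pt_apply_one] at this; omega
  -- `i₀ ≥ 3`: otherwise `ω (i₀−2)` is the root, `xm = 1`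
  have hi₀3 : 3 ≤ i₀ := by
    by_contra hlt
    have h2 : i₀ - 2 = 0 := by omega
    rw [h2, h0] at hp2
    have e0 := congrFun hp2 0; simp at e0; omega
  -- `ω (i₀−3) = (xm−1, H−2)`
  have p3 : ω (i₀ - 3) = pt (xm - 1) (H - 2) := by
    have hadj : brickWallGraph.Adj (ω (i₀ - 2)) (ω (i₀ - 3)) := by
      have := hbw (i₀ - 3) (by omega); rw [show i₀ - 3 + 1 = i₀ - 2 by omega] at this; exact this.symm
    rw [hp2] at hadj
    have hne1 : ω (i₀ - 3) ≠ ω (i₀ - 1) := fun h => by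
      have := hinj (show i₀ - 3 ∈ {i | i ≤ n} by simp; omega) (show i₀ - 1 ∈ {i | i ≤ n} by simp; omega) h; omega
    have hne3 : ω (i₀ - 3) ≠ ω (i₀ + 3) := fun h => by
      have := hinj (show i₀ - 3 ∈ {i | i ≤ n} by simp; omega) (show i₀ + 3 ∈ {i | i ≤ n} by simp; omega) h; omega
    rcases adj_cases hadj with ⟨hz0, hz1⟩ | ⟨hz0, hz1⟩ | hz0
    · exfalso; apply hne1; rw [hp1, ls_site_eq_iff]; simp only [pt_apply_zero, pt_apply_one] at hz0 hz1 ⊢; omega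
    · exfalso; apply hne3; rw [s3, ls_site_eq_iff]; simp only [pt_apply_zero, pt_apply_one] at hz0 hz1 ⊢; omega
    · rcases vertical_cases hadj hz0 with ⟨hy, hp⟩ | ⟨hy, hp⟩
      · exfalso; simp only [pt_apply_zero, pt_apply_one] at hz0 hy hp; omega
      · rw [ls_site_eq_iff]; simp only [pt_apply_zero, pt_apply_one] at hz0 hy ⊢; omega
  have hX5 := free5_of_free4 hE hpar hH1 hmaxH hX4
  have hw : ∀ s, s ≤ 8 → ω (i₀ - 3 + s) = tpath wU 8 xm H false s := by
    intro s hs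
    interval_cases s
    · exact tpath_eq (by rw [show i₀ - 3 + 0 = i₀ - 3 by omega, p3]) (by simp [rd, wU])
    · exact tpath_eq (by rw [show i₀ - 3 + 1 = i₀ - 2 by omega, hp2]) (by simp [rd, wU])
    · exact tpath_eq (by rw [show i₀ - 3 + 2 = i₀ - 1 by omega, hp1]) (by simp [rd, wU])
    · exact tpath_eq (by rw [show i₀ - 3 + 3 = i₀ by omega, hv]) (by simp [rd, wU])
    · exact tpath_eq (by rw [show i₀ - 3 + 4 = i₀ + 1 by omega, s1]) (by simp [rd, wU])
    · exact tpath_eq (by rw [show i₀ - 3 + 5 = i₀ + 2 by omega, s2]) (by simp [rd, wU])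
    · exact tpath_eq (by rw [show i₀ - 3 + 6 = i₀ + 3 by omega, s3]) (by simp [rd, wU])
    · exact tpath_eq (by rw [show i₀ - 3 + 7 = i₀ + 4 by omega, s4]) (by simp [rd, wU])
    · exact tpath_eq (by rw [show i₀ - 3 + 8 = i₀ + 5 by omega, hs5]) (by simp [rd, wU])
  exact ⟨hx5, hi₀3, spliceOK_U hE hpar hx5 hH1 hmaxH hmaxX hX3 hX4 hX5 hw (by omega), hw⟩

end SlideData


/-! ### The image: top corner, a site it carries, a site it avoids; decoding -/

section SlideImage

variable {xm H : ℤ} {fwd : Bool} {j : ℕ}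

/-- **Top corner of a slide image**: `(xm − 3, H + 1)`, at table index `5` — time `j + 5` in BOTH orientations.
[cite: MadrasSlade1993, §3.2 (proof of Theorem 3.2.3: the lexicographically largest point)] -/
theorem topAt_spliceU (hmaxH : ∀ i, i ≤ n → ω i 1 ≤ H) (hmaxX : ∀ i, i ≤ n → ω i 1 = H → ω i 0 ≤ xm)
    (hP : SpliceAddOK n 2 8 ω j (tpath offU 10 xm H fwd)) :
    TopSix (n + 2) (spliceAdd 2 8 ω (tpath offU 10 xm H fwd) j) (H + 1) (xm + (-3)) (j + rd fwd 10 5) :=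
  topAt_spliceAdd hmaxH hmaxX hP (by norm_num) (by omega) (fun u hu => by
    interval_cases u <;> simp only [offU] <;> omega) (by norm_num) rfl

/-- The corner time of a slide image is `j + 5` in both orientations. [cite: MadrasSlade1993, §3.2] -/
theorem rd_ten_five : rd fwd 10 5 = 5 := by unfold rd; split_ifs <;> rfl

/-- **The slide image carries the site `(xm−4, H)`** (one step down-left of its corner; table index `1`).
[cite: MadrasSlade1993, §3.2 (proof of Theorem 3.2.3)] -/
theorem spliceU_has_site1 (hP : SpliceAddOK n 2 8 ω j (tpath offU 10 xm H fwd)) :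
    ∃ t, t ≤ n + 2 ∧ spliceAdd 2 8 ω (tpath offU 10 xm H fwd) j t = pt (xm - 4) H := by
  have hwnd := hP.wnd
  refine ⟨j + rd fwd 10 1, by unfold rd; split_ifs <;> omega, ?_⟩
  rw [spliceAdd_mid hP.start (rd_le (by norm_num)), tpath]
  have : rd fwd 10 (rd fwd 10 1) = 1 := by unfold rd; split_ifs <;> omega
  rw [this]; simp only [offU]; exact pt_inj.2 ⟨by ring, by ring⟩

/-- **The slide image avoids the site `(xm−6, H+1)`** (three steps left of its corner on the new top row): the new path has abscissae
`≥ xm − 5` at height `H + 1`, the old sites have height `≤ H`. [cite: MadrasSlade1993, §3.2 (proof of Theorem 3.2.3)] -/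
theorem spliceU_free_left3 (hmaxH : ∀ i, i ≤ n → ω i 1 ≤ H) (hP : SpliceAddOK n 2 8 ω j (tpath offU 10 xm H fwd)) :
    ∀ t, t ≤ n + 2 → spliceAdd 2 8 ω (tpath offU 10 xm H fwd) j t ≠ pt (xm - 6) (H + 1) := by
  intro t ht he
  rcases spliceAdd_site_cases hP ht with ⟨a, ha, -, hta⟩ | ⟨s, hs, hts⟩
  · rw [hta] at he; have := hmaxH a ha; rw [he] at this; simp only [pt_apply_one] at this; omega
  · rw [hts, tpath] at he
    obtain ⟨e1, e2⟩ := pt_inj.1 he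
    have hr := rd_le (fwd := fwd) hs
    generalize rd fwd 10 s = u at e1 e2 hr
    interval_cases u <;> simp only [offU] at e1 e2 <;> omega

/-- Site of the slide image at time `j + 6` (one step after the corner time): `(xm−3, H)` forward, `(xm−4, H+1)` backward — their
heights differ, which pins the orientation. [cite: MadrasSlade1993, §3.2 (proof of Theorem 3.2.3)] -/
theorem spliceU_at_six (hP : SpliceAddOK n 2 8 ω j (tpath offU 10 xm H fwd)) :
    (fwd = true → spliceAdd 2 8 ω (tpath offU 10 xm H fwd) j (j + 6) = pt (xm - 3) H) ∧
    (fwd = false → spliceAdd 2 8 ω (tpath offU 10 xm H fwd) j (j + 6) = pt (xm - 4) (H + 1)) := by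
  constructor <;> (rintro rfl; rw [spliceAdd_mid hP.start (by norm_num)]; simp [tpath, rd, offU]) <;> ring_nf

/-- Site of the slide image at time `j + 4`: `(xm−4, H+1)` forward, `(xm−3, H)` backward. [cite: MadrasSlade1993, §3.2] -/
theorem spliceU_at_four (hP : SpliceAddOK n 2 8 ω j (tpath offU 10 xm H fwd)) :
    (fwd = true → spliceAdd 2 8 ω (tpath offU 10 xm H fwd) j (j + 4) = pt (xm - 4) (H + 1)) ∧
    (fwd = false → spliceAdd 2 8 ω (tpath offU 10 xm H fwd) j (j + 4) = pt (xm - 3) H) := by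
  constructor <;> (rintro rfl; rw [spliceAdd_mid hP.start (by norm_num)]; simp [tpath, rd, offU]) <;> ring_nf

/-- Site of the slide image two steps after the corner in its own direction — at `j + 7` forward, `j + 3` backward: `(xm−2, H)`, the
RIGHT neighbour of the site below the corner (the top-right hexagon of the image is an up-LEFT leaf). [cite: MadrasSlade1993, §3.2] -/
theorem spliceU_turn_right (hP : SpliceAddOK n 2 8 ω j (tpath offU 10 xm H fwd)) :
    (fwd = true → spliceAdd 2 8 ω (tpath offU 10 xm H fwd) j (j + 7) = pt (xm - 2) H) ∧
    (fwd = false → spliceAdd 2 8 ω (tpath offU 10 xm H fwd) j (j + 3) = pt (xm - 2) H) := by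
  constructor <;> (rintro rfl; rw [spliceAdd_mid hP.start (by norm_num)]; simp [tpath, rd, offU]) <;> ring_nf

/-- **Decoding within the slide class**: two canonical polygons with slide surgeries whose images coincide are equal — the image's
top corner pins `(xm, H)` and the window position (`j + 5` in both orientations), the height of the site at time `j + 6` pins the
orientation, and `eq_of_spliceAdd_eq` reads `ω` off. [cite: MadrasSlade1993, §3.2 (proof of Theorem 3.2.3: "Q can be unambiguously determined")] -/
theorem spliceU_decode {ω₁ ω₂ : ℕ → Site 2} {xm₁ H₁ xm₂ H₂ : ℤ} {j₁ j₂ : ℕ} {fwd₁ fwd₂ : Bool}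
    (hω₁ : ω₁ ∈ canonEnd n) (hω₂ : ω₂ ∈ canonEnd n)
    (hmaxH₁ : ∀ i, i ≤ n → ω₁ i 1 ≤ H₁) (hmaxX₁ : ∀ i, i ≤ n → ω₁ i 1 = H₁ → ω₁ i 0 ≤ xm₁)
    (hmaxH₂ : ∀ i, i ≤ n → ω₂ i 1 ≤ H₂) (hmaxX₂ : ∀ i, i ≤ n → ω₂ i 1 = H₂ → ω₂ i 0 ≤ xm₂)
    (hP₁ : SpliceAddOK n 2 8 ω₁ j₁ (tpath offU 10 xm₁ H₁ fwd₁)) (hP₂ : SpliceAddOK n 2 8 ω₂ j₂ (tpath offU 10 xm₂ H₂ fwd₂))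
    (hw₁ : ∀ s, s ≤ 8 → ω₁ (j₁ + s) = tpath wU 8 xm₁ H₁ fwd₁ s) (hw₂ : ∀ s, s ≤ 8 → ω₂ (j₂ + s) = tpath wU 8 xm₂ H₂ fwd₂ s)
    (h : spliceAdd 2 8 ω₁ (tpath offU 10 xm₁ H₁ fwd₁) j₁ = spliceAdd 2 8 ω₂ (tpath offU 10 xm₂ H₂ fwd₂) j₂) : ω₁ = ω₂ := by
  obtain ⟨hE₁, -⟩ := mem_canonEnd.1 hω₁
  obtain ⟨hE₂, -⟩ := mem_canonEnd.1 hω₂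
  have hW : spliceAdd 2 8 ω₁ (tpath offU 10 xm₁ H₁ fwd₁) j₁ ∈ endAt (n + 2) (Pi.single 0 1 : Site 2) := spliceAdd_mem hE₁ hP₁
  have hinj := (mem_endAt_iff.1 hW).1.2.2.2
  have T₁ := topAt_spliceU hmaxH₁ hmaxX₁ hP₁
  have T₂ := topAt_spliceU hmaxH₂ hmaxX₂ hP₂
  rw [← h] at T₂
  obtain ⟨eH, ex, eτ⟩ := topAt_unique hinj T₁ T₂
  rw [rd_ten_five, rd_ten_five] at eτ
  have eH' : H₁ = H₂ := by omega
  have ex' : xm₁ = xm₂ := by omega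
  have ej : j₁ = j₂ := by omega
  subst eH' ex' ej
  -- orientation from the height at time `j + 6`
  have A₁ := spliceU_at_six hP₁
  have A₂ := spliceU_at_six hP₂
  rw [← h] at A₂
  cases fwd₁ <;> cases fwd₂
  · exact eq_of_spliceAdd_eq hE₁ hE₂ hP₁ hP₂ hw₁ hw₂ h
  · exfalso; have e := (A₁.2 rfl).symm.trans (A₂.1 rfl); have := (pt_inj.1 e).2; omega
  · exfalso; have e := (A₁.1 rfl).symm.trans (A₂.2 rfl); have := (pt_inj.1 e).2; omega
  · exact eq_of_spliceAdd_eq hE₁ hE₂ hP₁ hP₂ hw₁ hw₂ h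

/-- **A slide image is not in the leaf class**: at its top corner the walk steps down and then RIGHT (in its own direction), while a
leaf steps down and then LEFT; in the other time direction the neighbour of the corner is on the new top row, not below it.
[cite: MadrasSlade1993, §3.2 (proof of Theorem 3.2.3)] -/
theorem not_isTopLeaf_spliceU (hω : ω ∈ canonEnd n)
    (hmaxH : ∀ i, i ≤ n → ω i 1 ≤ H) (hmaxX : ∀ i, i ≤ n → ω i 1 = H → ω i 0 ≤ xm)
    (hP : SpliceAddOK n 2 8 ω j (tpath offU 10 xm H fwd)) : ¬ IsTopLeaf (n + 2) (spliceAdd 2 8 ω (tpath offU 10 xm H fwd) j) := by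
  intro hleaf
  obtain ⟨hE, -⟩ := mem_canonEnd.1 hω
  obtain ⟨H', x', τ, T', -, hpat⟩ := topSix_of_isTopLeaf hleaf
  have hW := spliceAdd_mem hE hP
  have hinj := (mem_endAt_iff.1 hW).1.2.2.2
  obtain ⟨eH, ex, eτ⟩ := topAt_unique hinj (topAt_spliceU hmaxH hmaxX hP) T'
  rw [rd_ten_five] at eτ
  have A6 := spliceU_at_six hP
  have A4 := spliceU_at_four hP
  have AR := spliceU_turn_right hP
  cases fwd
  · rcases hpat with ⟨-, h1, -⟩ | ⟨-, -, h2⟩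
    · rw [← eτ, A6.2 rfl] at h1; have := (pt_inj.1 h1).2; omega
    · rw [← eτ, show j + 5 - 2 = j + 3 by omega, AR.2 rfl] at h2; have := (pt_inj.1 h2).1; omega
  · rcases hpat with ⟨-, -, h2⟩ | ⟨-, h1, -⟩
    · rw [← eτ, show j + 5 + 2 = j + 7 by omega, AR.1 rfl] at h2; have := (pt_inj.1 h2).1; omega
    · rw [← eτ, show j + 5 - 1 = j + 4 by omega, A4.1 rfl] at h1; have := (pt_inj.1 h1).2; omega

/-- **A case-X image avoids the site `(xm−2, H)`** under its top hexagon (it became an interior vertex): the new path misses it and on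
`ω` it is the middle window site, met by no time outside the window. [cite: MadrasSlade1993, §3.2 (proof of Theorem 3.2.3)] -/
theorem spliceX_free_under {xm H : ℤ} {fwd : Bool} {j : ℕ} (hω : ω ∈ endAt n (Pi.single 0 1 : Site 2))
    (hP : SpliceAddOK n 2 2 ω j (tpath offX 4 xm H fwd)) (hw : ∀ s, s ≤ 2 → ω (j + s) = tpath w6A 2 xm H fwd s) :
    ∀ t, t ≤ n + 2 → spliceAdd 2 2 ω (tpath offX 4 xm H fwd) j t ≠ pt (xm - 2) H := by
  have hinj := (mem_endAt_iff.1 hω).1.2.2.2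
  have hwnd := hP.wnd
  intro t ht he
  rcases spliceAdd_site_cases hP ht with ⟨a, ha, hao, hta⟩ | ⟨s, hs, hts⟩
  · -- `(xm−2, H)` is `ω (j+1)` (window index `1` in both orientations)
    have e1 : ω (j + 1) = pt (xm - 2) H := by
      rw [hw 1 (by norm_num), tpath]; cases fwd <;> simp [rd, w6A] <;> ring_nf
    rw [hta] at he
    have := hinj (show a ∈ {i | i ≤ n} by simpa using ha) (show j + 1 ∈ {i | i ≤ n} by simp; omega) (by rw [he, e1])
    omega
  · rw [hts, tpath] at he
    obtain ⟨e1, e2⟩ := pt_inj.1 he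
    have hr := rd_le (fwd := fwd) hs
    generalize rd fwd 4 s = u at e1 e2 hr
    interval_cases u <;> simp only [offX] at e1 e2 <;> omega

/-- **A slide image is not a top image of the two-corner map** (no `RoofDatum` from any source of `canonEnd n`): against a case-X image
the site `(xm−4, H)` of the slide image is the site under the X-image's top hexagon, which that image avoids; against a roof image, the
roof carries the top-row site three steps left of its corner, which the slide image avoids.
[cite: MadrasSlade1993, §3.2 (proof of Theorem 3.2.3: "Q can be unambiguously determined")] -/
theorem spliceU_ne_roof {ω₁ ω₂ : ℕ → Site 2} {xm₁ H₁ : ℤ} {j₁ : ℕ} {fwd₁ : Bool} {H₂ xm₂ : ℤ} {j₂ k₂ : ℕ} {fwd₂ : Bool}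
    (hω₁ : ω₁ ∈ canonEnd n) (hω₂ : ω₂ ∈ canonEnd n) (hn : 2 ≤ n)
    (hmaxH₁ : ∀ i, i ≤ n → ω₁ i 1 ≤ H₁) (hmaxX₁ : ∀ i, i ≤ n → ω₁ i 1 = H₁ → ω₁ i 0 ≤ xm₁)
    (hmaxH₂ : ∀ i, i ≤ n → ω₂ i 1 ≤ H₂) (hmaxX₂ : ∀ i, i ≤ n → ω₂ i 1 = H₂ → ω₂ i 0 ≤ xm₂)
    (hP₁ : SpliceAddOK n 2 8 ω₁ j₁ (tpath offU 10 xm₁ H₁ fwd₁))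
    (hd₂ : RoofDatum n ω₂ (spliceAdd 2 8 ω₁ (tpath offU 10 xm₁ H₁ fwd₁) j₁) H₂ xm₂ j₂ k₂ fwd₂) : False := by
  obtain ⟨hE₁, -⟩ := mem_canonEnd.1 hω₁
  obtain ⟨hE₂, -⟩ := mem_canonEnd.1 hω₂
  have hW := spliceAdd_mem hE₁ hP₁
  have hinj := (mem_endAt_iff.1 hW).1.2.2.2
  have T₁ := topAt_spliceU hmaxH₁ hmaxX₁ hP₁
  rcases hd₂ with ⟨hP₂, hw₂, -, -, hWeq⟩ | ⟨hk, hP₂, -, hpre, hpost, hWeq⟩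
  · -- case X image: corners `(xm₁−3, H₁+1) = (xm₂−1, H₂+1)`
    have T₂ := topAt_spliceX hmaxH₂ hmaxX₂ hP₂
    rw [← hWeq] at T₂
    obtain ⟨eH, ex, -⟩ := topAt_unique hinj T₁ T₂
    obtain ⟨t, ht, e⟩ := spliceU_has_site1 hP₁
    rw [hWeq] at e
    exact spliceX_free_under hE₂ hP₂ hw₂ t ht (by rw [e]; exact pt_inj.2 ⟨by omega, by omega⟩)
  · -- roof image: corners `(xm₁−3, H₁+1) = (xm₂+2k₂, H₂)`; the roof carries `(xm₂+2k₂−3, H₂)`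
    have T₂ := topAt_spliceYs hmaxH₂ hmaxX₂ hP₂
    rw [← hWeq] at T₂
    obtain ⟨eH, ex, -⟩ := topAt_unique hinj T₁ T₂
    have hfr := (mem_endAt_iff.1 hE₂).1.2.1
    have hwnd := hP₂.wnd
    have hH1 : 1 ≤ H₂ := by
      have h1 := apply_one_of_mem_canonEnd hω₂ hn
      have := hmaxH₂ 1 (by omega); rw [h1.2] at this; exact this
    obtain ⟨t, ht, e⟩ : ∃ t, t ≤ n + 2 ∧
        spliceAdd 2 (2 * k₂) ω₂ (tpath (offYs k₂) (2 * k₂ + 2) xm₂ H₂ fwd₂) j₂ t = pt (xm₂ + 2 * k₂ - 3) H₂ := by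
      cases fwd₂
      · rcases Nat.lt_or_ge k₂ 2 with hk1 | hk2
        · obtain ⟨q1, -, -⟩ := hpost rfl
          have hb : j₂ + 2 * k₂ + 1 ≤ n := by
            by_contra hlt
            rw [hfr (j₂ + 2 * k₂ + 1) (by omega), (mem_endAt_iff.1 hE₂).2] at q1
            have := congrFun q1 1; simp at this; omega
          refine ⟨j₂ + 2 * k₂ + 3, by omega, ?_⟩
          rw [spliceAdd_of_ge hP₂.finish (by omega), show j₂ + 2 * k₂ + 3 - 2 = j₂ + 2 * k₂ + 1 by omega, q1]
          exact pt_inj.2 ⟨by omega, rfl⟩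
        · exact ⟨j₂ + (2 + 3), by omega, by exact_mod_cast (spliceYs_sites_bwd hP₂).1 3 (by omega)⟩
      · rcases Nat.lt_or_ge k₂ 2 with hk1 | hk2
        · obtain ⟨hj3, q1, -, -⟩ := hpre rfl
          refine ⟨j₂ - 1, by omega, ?_⟩
          rw [spliceAdd_of_le (by omega), q1]
          exact pt_inj.2 ⟨by omega, rfl⟩
        · have e := (spliceYs_sites_fwd hP₂).1 (2 * k₂ - 3) (by omega)
          refine ⟨j₂ + (2 * k₂ - 3), by omega, ?_⟩
          rw [e]; exact pt_inj.2 ⟨by omega, rfl⟩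
    rw [← hWeq] at e
    exact spliceU_free_left3 hmaxH₁ hP₁ t ht (by rw [e]; exact pt_inj.2 ⟨by omega, by omega⟩)

end SlideImage


/-! ### PART II — the class, the datum, and the three-slot injection -/

section ThreeSlot

/-- **The leaf-slide class**: a top corner `(xm, H) = ω i₀` of the LEAF class (`(xm−3,H)` off `ω`; below the corner the walk steps down
and then LEFT, forward or backward in time) whose support run is long — the site five steps away from the corner on the far side is
`(xm−4, H−1)` — and with `(xm−4, H)` off `ω` (the hexagon two places left of the top-right hexagon is absent).
[cite: MadrasSlade1993, §3.2 (proof of Theorem 3.2.3: surgery at the lexicographically largest point)] -/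
def IsLeafSlide (n : ℕ) (ω : ℕ → Site 2) : Prop :=
  ∃ (H xm : ℤ) (i₀ : ℕ), i₀ + 1 ≤ n ∧ ω i₀ = pt xm H ∧ 2 ≤ xm ∧
    (∀ i, i ≤ n → ω i 1 ≤ H) ∧ (∀ i, i ≤ n → ω i 1 = H → ω i 0 ≤ xm) ∧
    (∀ t, t ≤ n → ω t ≠ pt (xm - 3) H) ∧ (∀ t, t ≤ n → ω t ≠ pt (xm - 4) H) ∧
    ((i₀ + 2 ≤ n ∧ ω (i₀ + 1) = pt xm (H - 1) ∧ ω (i₀ + 2) = pt (xm - 1) (H - 1) ∧ 5 ≤ i₀ ∧ ω (i₀ - 5) = pt (xm - 4) (H - 1)) ∨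
      (2 ≤ i₀ ∧ ω (i₀ - 1) = pt xm (H - 1) ∧ ω (i₀ - 2) = pt (xm - 1) (H - 1) ∧ i₀ + 5 ≤ n ∧ ω (i₀ + 5) = pt (xm - 4) (H - 1)))

/-- A polygon of the leaf-slide class is in the leaf class. [cite: MadrasSlade1993, §3.2 (proof of Theorem 3.2.3)] -/
theorem isTopLeaf_of_isLeafSlide (h : IsLeafSlide n ω) : IsTopLeaf n ω := by
  obtain ⟨H, xm, i₀, hi₀n, hv, hx2, hmaxH, hmaxX, hX3, -, hpat⟩ := h
  rcases hpat with ⟨h2n, h1, h2, -, -⟩ | ⟨h2, h1, h2', -, -⟩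
  · exact ⟨H, xm, i₀, hi₀n, hv, hx2, hmaxH, hmaxX, hX3, Or.inl ⟨h2n, h1, h2⟩⟩
  · exact ⟨H, xm, i₀, hi₀n, hv, hx2, hmaxH, hmaxX, hX3, Or.inr ⟨h2, h1, h2'⟩⟩

/-- The decoding datum of a slide image. [cite: MadrasSlade1993, §3.2 (proof of Theorem 3.2.3)] -/
def SlideDatum (n : ℕ) (ω W : ℕ → Site 2) (H xm : ℤ) (j : ℕ) (fwd : Bool) : Prop :=
  SpliceAddOK n 2 8 ω j (tpath offU 10 xm H fwd) ∧ (∀ s, s ≤ 8 → ω (j + s) = tpath wU 8 xm H fwd s) ∧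
    W = spliceAdd 2 8 ω (tpath offU 10 xm H fwd) j

/-- **An image with its decoding datum** for every polygon of the leaf-slide class. [cite: MadrasSlade1993, §3.2 (proof of Theorem 3.2.3)] -/
theorem exists_leafSlide_image (hω : ω ∈ canonEnd n) (hm : IsLeafSlide n ω) :
    ∃ W : ℕ → Site 2, W ∈ canonEnd (n + 2) ∧ ∃ (H xm : ℤ) (j : ℕ) (fwd : Bool),
      (∀ i, i ≤ n → ω i 1 ≤ H) ∧ (∀ i, i ≤ n → ω i 1 = H → ω i 0 ≤ xm) ∧ SlideDatum n ω W H xm j fwd := by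
  obtain ⟨H, xm, i₀, hi₀n, hv, hx2, hmaxH, hmaxX, hX3, hX4, hpat⟩ := hm
  rcases hpat with ⟨h2n, h1, h2, hi₀5, h5⟩ | ⟨hi₀2, h1, h2, h5n, h5⟩
  · obtain ⟨-, -, hP, hw⟩ := stepTwo_data_U_fwd hω h2n hv hx2 hmaxH hmaxX hX3 hX4 h1 h2 hi₀5 h5
    exact ⟨_, spliceAdd_mem_canonEnd hω hP, H, xm, i₀ - 5, true, hmaxH, hmaxX, hP, hw, rfl⟩
  · obtain ⟨-, -, hP, hw⟩ := stepTwo_data_U_bwd hω hi₀2 h5n hv hx2 hmaxH hmaxX hX3 hX4 h1 h2 h5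
    exact ⟨_, spliceAdd_mem_canonEnd hω hP, H, xm, i₀ - 3, false, hmaxH, hmaxX, hP, hw, rfl⟩

/-- **Decoding of slide images is datum-free.** [cite: MadrasSlade1993, §3.2 (proof of Theorem 3.2.3: "Q can be unambiguously determined")] -/
theorem eq_of_leafSlide_image_eq {ω₁ ω₂ W : ℕ → Site 2} (hω₁ : ω₁ ∈ canonEnd n) (hω₂ : ω₂ ∈ canonEnd n)
    {H₁ xm₁ : ℤ} {j₁ : ℕ} {fwd₁ : Bool} {H₂ xm₂ : ℤ} {j₂ : ℕ} {fwd₂ : Bool}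
    (hmaxH₁ : ∀ i, i ≤ n → ω₁ i 1 ≤ H₁) (hmaxX₁ : ∀ i, i ≤ n → ω₁ i 1 = H₁ → ω₁ i 0 ≤ xm₁)
    (hmaxH₂ : ∀ i, i ≤ n → ω₂ i 1 ≤ H₂) (hmaxX₂ : ∀ i, i ≤ n → ω₂ i 1 = H₂ → ω₂ i 0 ≤ xm₂)
    (h₁ : SlideDatum n ω₁ W H₁ xm₁ j₁ fwd₁) (h₂ : SlideDatum n ω₂ W H₂ xm₂ j₂ fwd₂) : ω₁ = ω₂ := by
  obtain ⟨hP₁, hw₁, rfl⟩ := h₁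
  obtain ⟨hP₂, hw₂, h⟩ := h₂
  exact spliceU_decode hω₁ hω₂ hmaxH₁ hmaxX₁ hmaxH₂ hmaxX₂ hP₁ hP₂ hw₁ hw₂ h

/-- **The class served by the three slots**: the two-corner class, or the leaf-slide class.
[cite: MadrasSlade1993, §3.2 (proof of Theorem 3.2.3)] -/
def IsStepTwoThreeSlot (n : ℕ) (ω : ℕ → Site 2) : Prop := IsStepTwoTwoCorner n ω ∨ IsLeafSlide n ω

/-- **★ The step two holds on the three-slot class**: the canonical rooted `(n+1)`-gons (`n ≥ 5`) of class
X ∪ Y⋆ ∪ (leaf ∩ bottom-served) ∪ leaf-slide inject into the canonical rooted `(n+3)`-gons.  Images of the three kinds are pairwise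
distinct: top images are not top-leaf and carry a `RoofDatum`; bottom images are top-leaf; slide images are neither top-leaf nor carry a
`RoofDatum`. [cite: MadrasSlade1993, §3.2, Theorem 3.2.3 / (3.2.3) (the `ℤ^d` statement being transplanted)] -/
theorem card_filter_isStepTwoThreeSlot_le [DecidablePred (IsStepTwoThreeSlot n)] (hn : 5 ≤ n) :
    #((canonEnd n).filter (IsStepTwoThreeSlot n)) ≤ #(canonEnd (n + 2)) := by
  classical
  -- the three branches, by priority: top (roof), bottom, slide
  let P1 : (ℕ → Site 2) → Prop := fun ω => ω ∈ canonEnd n ∧ IsStepTwoRoof n ω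
  let P2 : (ℕ → Site 2) → Prop := fun ω => ω ∈ canonEnd n ∧ IsTopLeaf n ω ∧ IsStepTwoBottom n ω
  let P3 : (ℕ → Site 2) → Prop := fun ω => ω ∈ canonEnd n ∧ IsLeafSlide n ω
  let E : (ℕ → Site 2) → (ℕ → Site 2) := fun ω =>
    if h : P1 ω then Classical.choose (exists_stepTwoRoof_image h.1 hn h.2)
    else if h' : P2 ω then Classical.choose (exists_stepTwoBottom_image h'.1 hn h'.2.2)
    else if h'' : P3 ω then Classical.choose (exists_leafSlide_image h''.1 h''.2)
    else ω
  have hE1 : ∀ ω (h : P1 ω), E ω = Classical.choose (exists_stepTwoRoof_image h.1 hn h.2) := fun ω h => dif_pos h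
  have hE2 : ∀ ω, ¬ P1 ω → ∀ h' : P2 ω, E ω = Classical.choose (exists_stepTwoBottom_image h'.1 hn h'.2.2) := by
    intro ω h1 h'
    show (if h : P1 ω then _ else _) = _
    rw [dif_neg h1, dif_pos h']
  have hE3 : ∀ ω, ¬ P1 ω → ¬ P2 ω → ∀ h'' : P3 ω, E ω = Classical.choose (exists_leafSlide_image h''.1 h''.2) := by
    intro ω h1 h2 h''
    show (if h : P1 ω then _ else _) = _
    rw [dif_neg h1, dif_neg h2, dif_pos h'']
  -- the three kinds of images
  have himgR : ∀ ω (h : P1 ω), E ω ∈ canonEnd (n + 2) ∧ ¬ IsTopLeaf (n + 2) (E ω) ∧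
      ∃ (H xm : ℤ) (j k : ℕ) (fwd : Bool), (∀ i, i ≤ n → ω i 1 ≤ H) ∧ (∀ i, i ≤ n → ω i 1 = H → ω i 0 ≤ xm) ∧
        RoofDatum n ω (E ω) H xm j k fwd := by
    intro ω h
    rw [hE1 ω h]
    obtain ⟨hW, H, xm, j, k, fwd, hmaxH, hmaxX, hd⟩ := Classical.choose_spec (exists_stepTwoRoof_image h.1 hn h.2)
    exact ⟨hW, not_isTopLeaf_of_roofDatum h.1 (by omega) hmaxH hmaxX hd, H, xm, j, k, fwd, hmaxH, hmaxX, hd⟩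
  have himgB : ∀ ω, ¬ P1 ω → ∀ h' : P2 ω, E ω ∈ canonEnd (n + 2) ∧ IsTopLeaf (n + 2) (E ω) ∧
      ∃ (L xb : ℤ) (j k : ℕ) (fwd : Bool), (∀ i, i ≤ n → L ≤ ω i 1) ∧ (∀ i, i ≤ n → ω i 1 = L → ω i 0 ≤ xb) ∧
        BottomDatum n ω (E ω) L xb j k fwd := by
    intro ω h1 h'
    rw [hE2 ω h1 h']
    obtain ⟨hW, L, xb, j, k, fwd, hminH, hmaxX, hd⟩ :=
      Classical.choose_spec (exists_stepTwoBottom_image h'.1 hn h'.2.2)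
    exact ⟨hW, isTopLeaf_of_bottomDatum h'.1 hd h'.2.1, L, xb, j, k, fwd, hminH, hmaxX, hd⟩
  have himgS : ∀ ω, ¬ P1 ω → ¬ P2 ω → ∀ h'' : P3 ω, E ω ∈ canonEnd (n + 2) ∧ ¬ IsTopLeaf (n + 2) (E ω) ∧
      ∃ (H xm : ℤ) (j : ℕ) (fwd : Bool), (∀ i, i ≤ n → ω i 1 ≤ H) ∧ (∀ i, i ≤ n → ω i 1 = H → ω i 0 ≤ xm) ∧
        SlideDatum n ω (E ω) H xm j fwd := by
    intro ω h1 h2 h''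
    rw [hE3 ω h1 h2 h'']
    obtain ⟨hW, H, xm, j, fwd, hmaxH, hmaxX, hd⟩ := Classical.choose_spec (exists_leafSlide_image h''.1 h''.2)
    refine ⟨hW, ?_, H, xm, j, fwd, hmaxH, hmaxX, hd⟩
    obtain ⟨hP, -, hWeq⟩ := hd
    rw [hWeq]; exact not_isTopLeaf_spliceU h''.1 hmaxH hmaxX hP
  -- every member of the class is in one of the three branches
  have hbranch : ∀ ω, ω ∈ canonEnd n → IsStepTwoThreeSlot n ω → P1 ω ∨ (¬ P1 ω ∧ P2 ω) ∨ (¬ P1 ω ∧ ¬ P2 ω ∧ P3 ω) := by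
    intro ω hω hc
    by_cases h1 : P1 ω
    · exact Or.inl h1
    by_cases h2 : P2 ω
    · exact Or.inr (Or.inl ⟨h1, h2⟩)
    refine Or.inr (Or.inr ⟨h1, h2, hω, ?_⟩)
    rcases hc with (hR | ⟨hl, hb⟩) | hs
    · exact absurd ⟨hω, hR⟩ h1
    · exact absurd ⟨hω, hl, hb⟩ h2
    · exact hs
  refine Finset.card_le_card_of_injOn E (fun ω hω => ?_) (fun ω₁ hω₁ ω₂ hω₂ heq => ?_)
  · rw [Finset.mem_coe, Finset.mem_filter] at hω
    rw [Finset.mem_coe]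
    rcases hbranch ω hω.1 hω.2 with h1 | ⟨h1, h2⟩ | ⟨h1, h2, h3⟩
    · exact (himgR ω h1).1
    · exact (himgB ω h1 h2).1
    · exact (himgS ω h1 h2 h3).1
  · rw [Finset.mem_coe, Finset.mem_filter] at hω₁ hω₂
    rcases hbranch ω₁ hω₁.1 hω₁.2 with a1 | ⟨a1, a2⟩ | ⟨a1, a2, a3⟩ <;>
      rcases hbranch ω₂ hω₂.1 hω₂.2 with b1 | ⟨b1, b2⟩ | ⟨b1, b2, b3⟩
    · obtain ⟨-, -, H₁, xm₁, j₁, k₁, fwd₁, hmaxH₁, hmaxX₁, h₁⟩ := himgR ω₁ a1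
      obtain ⟨-, -, H₂, xm₂, j₂, k₂, fwd₂, hmaxH₂, hmaxX₂, h₂⟩ := himgR ω₂ b1
      rw [heq] at h₁
      exact eq_of_stepTwoRoof_image_eq hω₁.1 hω₂.1 hmaxH₁ hmaxX₁ hmaxH₂ hmaxX₂ h₁ h₂
    · exfalso
      obtain ⟨-, hnl, -⟩ := himgR ω₁ a1
      obtain ⟨-, hl, -⟩ := himgB ω₂ b1 b2
      rw [heq] at hnl; exact hnl hl
    · exfalso
      obtain ⟨-, -, H₁, xm₁, j₁, k₁, fwd₁, hmaxH₁, hmaxX₁, h₁⟩ := himgR ω₁ a1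
      obtain ⟨-, -, H₂, xm₂, j₂, fwd₂, hmaxH₂, hmaxX₂, hP₂, -, hW₂⟩ := himgS ω₂ b1 b2 b3
      rw [heq, hW₂] at h₁
      exact spliceU_ne_roof hω₂.1 hω₁.1 (by omega) hmaxH₂ hmaxX₂ hmaxH₁ hmaxX₁ hP₂ h₁
    · exfalso
      obtain ⟨-, hnl, -⟩ := himgR ω₂ b1
      obtain ⟨-, hl, -⟩ := himgB ω₁ a1 a2
      rw [← heq] at hnl; exact hnl hl
    · obtain ⟨-, -, L₁, xb₁, j₁, k₁, fwd₁, hminH₁, hmaxX₁, h₁⟩ := himgB ω₁ a1 a2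
      obtain ⟨-, -, L₂, xb₂, j₂, k₂, fwd₂, hminH₂, hmaxX₂, h₂⟩ := himgB ω₂ b1 b2
      rw [heq] at h₁
      exact eq_of_stepTwoBottom_image_eq hω₁.1 hω₂.1 hminH₁ hmaxX₁ hminH₂ hmaxX₂ h₁ h₂
    · exfalso
      obtain ⟨-, hl, -⟩ := himgB ω₁ a1 a2
      obtain ⟨-, hnl, -⟩ := himgS ω₂ b1 b2 b3
      rw [heq] at hl; exact hnl hl
    · exfalso
      obtain ⟨-, -, H₂, xm₂, j₂, k₂, fwd₂, hmaxH₂, hmaxX₂, h₂⟩ := himgR ω₂ b1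
      obtain ⟨-, -, H₁, xm₁, j₁, fwd₁, hmaxH₁, hmaxX₁, hP₁, -, hW₁⟩ := himgS ω₁ a1 a2 a3
      rw [← heq, hW₁] at h₂
      exact spliceU_ne_roof hω₁.1 hω₂.1 (by omega) hmaxH₁ hmaxX₁ hmaxH₂ hmaxX₂ hP₁ h₂
    · exfalso
      obtain ⟨-, hnl, -⟩ := himgS ω₁ a1 a2 a3
      obtain ⟨-, hl, -⟩ := himgB ω₂ b1 b2
      rw [heq] at hnl; exact hnl hl
    · obtain ⟨-, -, H₁, xm₁, j₁, fwd₁, hmaxH₁, hmaxX₁, h₁⟩ := himgS ω₁ a1 a2 a3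
      obtain ⟨-, -, H₂, xm₂, j₂, fwd₂, hmaxH₂, hmaxX₂, h₂⟩ := himgS ω₂ b1 b2 b3
      rw [heq] at h₁
      exact eq_of_leafSlide_image_eq hω₁.1 hω₂.1 hmaxH₁ hmaxX₁ hmaxH₂ hmaxX₂ h₁ h₂

/-- **Complement form**: `#canonEnd n − #{leaf polygons neither served at the bottom nor by the slide} ≤ #canonEnd (n+2)`.
[cite: MadrasSlade1993, §3.2, Theorem 3.2.3 / (3.2.3)] -/
theorem card_canonEnd_sub_card_filter_threeSlotResidue_le [DecidablePred (IsStepTwoThreeSlot n)]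
    [DecidablePred fun ω => IsTopLeaf n ω ∧ ¬ IsStepTwoBottom n ω ∧ ¬ IsLeafSlide n ω] (hn : 5 ≤ n) :
    #(canonEnd n) - #((canonEnd n).filter fun ω => IsTopLeaf n ω ∧ ¬ IsStepTwoBottom n ω ∧ ¬ IsLeafSlide n ω) ≤
      #(canonEnd (n + 2)) := by
  classical
  have hcover : canonEnd n ⊆ (canonEnd n).filter (IsStepTwoThreeSlot n) ∪
      (canonEnd n).filter (fun ω => IsTopLeaf n ω ∧ ¬ IsStepTwoBottom n ω ∧ ¬ IsLeafSlide n ω) := by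
    intro ω hω
    rcases isStepTwoRoof_or_isTopLeaf hω hn with h | h
    · exact Finset.mem_union_left _ (Finset.mem_filter.2 ⟨hω, Or.inl (Or.inl h)⟩)
    · by_cases hb : IsStepTwoBottom n ω
      · exact Finset.mem_union_left _ (Finset.mem_filter.2 ⟨hω, Or.inl (Or.inr ⟨h, hb⟩)⟩)
      · by_cases hs : IsLeafSlide n ω
        · exact Finset.mem_union_left _ (Finset.mem_filter.2 ⟨hω, Or.inr hs⟩)
        · exact Finset.mem_union_right _ (Finset.mem_filter.2 ⟨hω, h, hb, hs⟩)
  have h1 := (Finset.card_le_card hcover).trans (Finset.card_union_le _ _)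
  have h2 := card_filter_isStepTwoThreeSlot_le (n := n) hn
  omega

/-- **Printed normalisation**: `q_{n+1}(ℍ) − #{three-slot residue} ≤ q_{n+3}(ℍ)` (`n ≥ 5`).
[cite: MadrasSlade1993, §3.2, Theorem 3.2.3 / (3.2.3)] -/
theorem hexPolygonNumber_sub_card_threeSlotResidue_le
    [DecidablePred fun ω => IsTopLeaf n ω ∧ ¬ IsStepTwoBottom n ω ∧ ¬ IsLeafSlide n ω] (hn : 5 ≤ n) :
    hexPolygonNumber (n + 1) - #((canonEnd n).filter fun ω => IsTopLeaf n ω ∧ ¬ IsStepTwoBottom n ω ∧ ¬ IsLeafSlide n ω) ≤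
      hexPolygonNumber (n + 3) := by
  classical
  have h := card_canonEnd_sub_card_filter_threeSlotResidue_le (n := n) hn
  rw [card_canonEnd (by omega), card_canonEnd (by omega)] at h
  exact h

/-- The three-slot class contains the two-corner class of `HexSAWPolygonStepTwoTwoCorner` (hence the classes of #502 and #441).
[cite: MadrasSlade1993, §3.2 (proof of Theorem 3.2.3)] -/
theorem card_filter_isStepTwoTwoCorner_le_card_filter_isStepTwoThreeSlot [DecidablePred (IsStepTwoTwoCorner n)]
    [DecidablePred (IsStepTwoThreeSlot n)] :
    #((canonEnd n).filter (IsStepTwoTwoCorner n)) ≤ #((canonEnd n).filter (IsStepTwoThreeSlot n)) :=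
  Finset.card_le_card fun ω hω => by
    rw [Finset.mem_filter] at hω ⊢
    exact ⟨hω.1, Or.inl hω.2⟩

end ThreeSlot

end PolygonConcat

end HexBW

end Literature.Probability.RandomPlanarGeometry.SAW

end
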